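import Mathlib.Data.Nat.Choose.Sum
import Summits.Ventures.PercRepro.RankLevelSetAvgCount
import Summits.Ventures.PercRepro.RankLevelSetAvgSupplyS

/-!
# PercRepro — [re-pointed at the primed (`_S`) parents per (um)(35)(2)–(4); the landed originals are the citations]
# PART 2 OF THE AVERAGED CHARGING, IN PAIRS FORM (night-1, gen 9 session 4; dossier §19.12 (d))

For a member `A` of `U(p,q)` on the tight layer with `F = cl(E ∖ A)`, `K = F ∖ (E ∖ A)`, `k = |K|`, `X = A ∖ F`
(`|X| = p − k`), every pair `(S₁, S₂)` with `∅ ≠ S₁ ⊆ K`, `∅ ≠ S₂ ⊆ X`, `|S₂| ≤ p − q − 1` gives the supply set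
`T = (E ∖ A) ∪ S₁ ∪ S₂` (dependent, rank in `[q+1, p−1]`: `supply_set_spec_S`), of weight `w(T) = n` if `r(T) = q+1`, else
`n − |T|`, shared by `m(T) = #{A′ ∈ U : E ∖ A′ ⊆ T} ≤ m̄(|S₁|, |S₂|)` members (`card_members_subset_le`).  Summing
`w(T)/m(T)` over the pairs gives at least
`NUM′(p,q,k) = Σ_{s₁=1}^{k} Σ_{s₂=1}^{p−q−1} C(k,s₁)·C(p−k,s₂)·w̄(s₁,s₂)/m̄(s₁,s₂)` (`dep_charge_pairs_ge`).
The binomial inequality `NUM′(p,q,k) ≥ Φ(p−1,q)·k` (exact for `p ≤ 100`, §19.12 (e)) is NOT proved here.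

Axioms: standard.
-/

namespace PercRepro

open Finset

/-- `m̄(q, k, s₁, s₂) = Σ_{j ≤ q−k} C(s₂, j)·C(q + s₁, q − j)`. -/
def mbar (q k s₁ s₂ : ℕ) : ℕ :=
  ∑ j ∈ Finset.range (q - k + 1), (s₂.choose j) * ((q + s₁).choose (q - j))

/-- `w̄(p, q, s₁, s₂) = n` if `s₂ = 1`, else `p − s₁ − s₂` (as a rational). -/
noncomputable def wbar (p q s₁ s₂ : ℕ) : ℚ :=
  if s₂ = 1 then ((p + q : ℕ) : ℚ) else (p : ℚ) - (s₁ : ℚ) - (s₂ : ℚ)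

/-- `NUM′(p,q,k)` of §19.12 (d). -/
noncomputable def numPrime (p q k : ℕ) : ℚ :=
  ∑ s₁ ∈ Finset.Icc 1 k, ∑ s₂ ∈ Finset.Icc 1 (p - q - 1),
    ((k.choose s₁ : ℕ) : ℚ) * (((p - k).choose s₂ : ℕ) : ℚ) * wbar p q s₁ s₂ / ((mbar q k s₁ s₂ : ℕ) : ℚ)

/-- `m̄ ≥ 1` (the `j = 0` term is `C(q+s₁, q) ≥ 1`). -/
lemma one_le_mbar (q k s₁ s₂ : ℕ) : 1 ≤ mbar q k s₁ s₂ := by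
  unfold mbar
  have h0 : 0 ∈ Finset.range (q - k + 1) := by simp
  calc 1 ≤ (s₂.choose 0) * ((q + s₁).choose (q - 0)) := by
        simp only [Nat.choose_zero_right, one_mul, Nat.sub_zero]
        exact Nat.choose_pos (by omega)
    _ ≤ ∑ j ∈ Finset.range (q - k + 1), (s₂.choose j) * ((q + s₁).choose (q - j)) :=
        Finset.single_le_sum (f := fun j => (s₂.choose j) * ((q + s₁).choose (q - j))) (fun _ _ => Nat.zero_le _) h0

open Set in
open scoped Classical in
/-- The rule's weight of a set: `n` at rank `q + 1`, `n − |T|` otherwise. -/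
noncomputable def ruleWeight {α : Type} (M : Matroid α) (q : ℕ) (T : Set α) : ℚ :=
  if M.eRk T = ((q + 1 : ℕ) : ℕ∞) then (M.E.ncard : ℚ) else (M.E.ncard : ℚ) - (T.ncard : ℚ)

open Set in
open scoped Classical in
/-- The rule's multiplicity of a set: the number of members `A′` of `U(p,q)` with `E ∖ A′ ⊆ T`. -/
noncomputable def ruleMult {α : Type} (M : Matroid α) [M.Finite] (p q : ℕ) (T : Set α) : ℕ :=
  ((Uset_finite_S M p q).toFinset.filter (fun A' => M.E \ A' ⊆ T)).card

open Set in
open scoped Classical in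
/-- **PART 2 IN PAIRS FORM**: for `A ∈ U(p,q)` on the tight layer (`1 ≤ q`, `q + 2 ≤ p`), with
`K = cl(E∖A) ∖ (E∖A)` and `X = A ∖ cl(E∖A)` as finsets,
`Σ_{∅≠S₁⊆K} Σ_{∅≠S₂⊆X, |S₂| ≤ p−q−1} w(T)/m(T) ≥ NUM′(p, q, |K|)` where `T = (E∖A) ∪ S₁ ∪ S₂`. -/
theorem dep_charge_pairs_ge {α : Type} (M : Matroid α) [M.Finite] {p q : ℕ} (hq : 1 ≤ q) (hpq : q + 2 ≤ p)
    (hE : M.E.ncard = p + q) {A : Set α} (hA : A ∈ Uset M p q)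
    (KF XF : Finset α) (hK : (KF : Set α) = M.closure (M.E \ A) \ (M.E \ A))
    (hX : (XF : Set α) = A \ M.closure (M.E \ A)) :
    numPrime p q KF.card ≤
      ∑ S₁ ∈ KF.powerset.filter (fun S₁ => 1 ≤ S₁.card),
        ∑ S₂ ∈ XF.powerset.filter (fun S₂ => 1 ≤ S₂.card ∧ S₂.card ≤ p - q - 1),
          ruleWeight M q ((M.E \ A) ∪ (S₁ : Set α) ∪ (S₂ : Set α)) /
            ((ruleMult M p q ((M.E \ A) ∪ (S₁ : Set α) ∪ (S₂ : Set α)) : ℕ) : ℚ) := by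
  have hEfin : M.E.Finite := M.set_finite M.E
  have hAE : A ⊆ M.E := hA.1
  obtain ⟨hAcard, hAc_card⟩ := ncard_compl_eq_of_mem_Uset_S M hE hA
  -- `|X| = p − |K|`
  have hXcard : XF.card = p - KF.card := by
    have h1 : (A ∩ M.closure (M.E \ A)).ncard + (A \ M.closure (M.E \ A)).ncard = A.ncard :=
      Set.ncard_inter_add_ncard_sdiff_eq_ncard A _ (hEfin.subset hAE)
    have h2 : A ∩ M.closure (M.E \ A) = M.closure (M.E \ A) \ (M.E \ A) := by
      ext x
      constructor
      · rintro ⟨hxA, hxF⟩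
        exact ⟨hxF, fun h => h.2 hxA⟩
      · rintro ⟨hxF, hxn⟩
        have hxE : x ∈ M.E := M.closure_subset_ground _ hxF
        exact ⟨by_contra (fun h => hxn ⟨hxE, h⟩), hxF⟩
    rw [h2, ← hK, ← hX, Set.ncard_coe_finset, Set.ncard_coe_finset, hAcard] at h1
    omega
  -- pointwise: each pair's term is at least `w̄/m̄`
  have hpt : ∀ S₁ ∈ KF.powerset.filter (fun S₁ => 1 ≤ S₁.card),
      ∀ S₂ ∈ XF.powerset.filter (fun S₂ => 1 ≤ S₂.card ∧ S₂.card ≤ p - q - 1),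
      wbar p q S₁.card S₂.card / ((mbar q KF.card S₁.card S₂.card : ℕ) : ℚ) ≤
        ruleWeight M q ((M.E \ A) ∪ (S₁ : Set α) ∪ (S₂ : Set α)) /
          ((ruleMult M p q ((M.E \ A) ∪ (S₁ : Set α) ∪ (S₂ : Set α)) : ℕ) : ℚ) := by
    intro S₁ hS₁ S₂ hS₂
    rw [Finset.mem_filter, Finset.mem_powerset] at hS₁ hS₂
    obtain ⟨hS₁K, hS₁c⟩ := hS₁
    obtain ⟨hS₂X, hS₂c1, hS₂c2⟩ := hS₂
    have hS₁' : (S₁ : Set α) ⊆ M.closure (M.E \ A) \ (M.E \ A) := by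
      rw [← hK]; exact Finset.coe_subset.2 hS₁K
    have hS₂' : (S₂ : Set α) ⊆ A \ M.closure (M.E \ A) := by
      rw [← hX]; exact Finset.coe_subset.2 hS₂X
    have hS₁ne : (S₁ : Set α).Nonempty := by
      rw [Finset.coe_nonempty, ← Finset.card_pos]; exact hS₁c
    have hS₂ne : (S₂ : Set α).Nonempty := by
      rw [Finset.coe_nonempty, ← Finset.card_pos]; exact hS₂c1
    set T : Set α := (M.E \ A) ∪ (S₁ : Set α) ∪ (S₂ : Set α) with hT
    -- the multiplicity: `1 ≤ m(T) ≤ m̄`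
    have hm_le : ruleMult M p q T ≤ mbar q KF.card S₁.card S₂.card := by
      unfold ruleMult mbar
      have h := card_members_subset_le M hE hA S₁ S₂ hS₁' hS₂'
      rw [← hK, Set.ncard_coe_finset] at h
      exact h
    have hm_pos : 1 ≤ ruleMult M p q T := by
      unfold ruleMult
      apply Finset.card_pos.2
      refine ⟨A, ?_⟩
      rw [Finset.mem_filter, Set.Finite.mem_toFinset]
      exact ⟨hA, fun x hx => Or.inl (Or.inl hx)⟩
    -- the weight: `w(T) ≥ w̄`
    have hTcard : T.ncard = q + S₁.card + S₂.card := by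
      have hd1 : Disjoint (M.E \ A) (S₁ : Set α) := by
        rw [Set.disjoint_left]; intro x hx hxS; exact (hS₁' hxS).2 hx
      have hd2 : Disjoint ((M.E \ A) ∪ (S₁ : Set α)) (S₂ : Set α) := by
        rw [Set.disjoint_left]
        rintro x (hx | hx) hxS
        · exact hx.2 (hS₂' hxS).1
        · exact (hS₂' hxS).2 (hS₁' hx).1
      rw [hT, Set.ncard_union_eq hd2 ((hEfin.subset sdiff_subset).union S₁.finite_toSet) S₂.finite_toSet,
        Set.ncard_union_eq hd1 (hEfin.subset sdiff_subset) S₁.finite_toSet, hAc_card,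
        Set.ncard_coe_finset, Set.ncard_coe_finset]
    have hw : wbar p q S₁.card S₂.card ≤ ruleWeight M q T := by
      unfold wbar ruleWeight
      by_cases h1 : S₂.card = 1
      · -- `S₂ = {t}`: rank exactly `q + 1`
        obtain ⟨t, ht⟩ := Finset.card_eq_one.1 h1
        have hrk : M.eRk T = ((q + 1 : ℕ) : ℕ∞) := by
          rw [hT, ht, Finset.coe_singleton]
          exact supply_set_eRk_of_singleton_S M hE hA hS₁' hS₁ne (by
            have := hS₂' (by rw [ht]; exact Finset.mem_singleton_self t)
            exact this)
        rw [if_pos h1, if_pos hrk, hE]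
      · rw [if_neg h1]
        split_ifs with h2
        · -- `n ≥ p − s₁ − s₂`
          rw [hE]; push_cast; linarith [(Nat.cast_nonneg (S₁.card) : (0 : ℚ) ≤ S₁.card),
            (Nat.cast_nonneg (S₂.card) : (0 : ℚ) ≤ S₂.card), (Nat.cast_nonneg q : (0 : ℚ) ≤ q)]
        · rw [hE, hTcard]; push_cast; linarith
    have hm_pos' : (0 : ℚ) < ((ruleMult M p q T : ℕ) : ℚ) := by exact_mod_cast hm_pos
    have hm_le' : ((ruleMult M p q T : ℕ) : ℚ) ≤ ((mbar q KF.card S₁.card S₂.card : ℕ) : ℚ) := by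
      exact_mod_cast hm_le
    have hk_le : KF.card ≤ q := by
      have h := ncard_sdiff_closure_add_excess_le_S M hE hA hA
      rw [← hK, Set.ncard_coe_finset] at h
      omega
    have hwbar_nonneg : 0 ≤ wbar p q S₁.card S₂.card := by
      unfold wbar
      split_ifs
      · positivity
      · have : S₁.card + S₂.card ≤ p := by
          have : S₁.card ≤ KF.card := Finset.card_le_card hS₁K
          omega
        have h' : (S₁.card : ℚ) + (S₂.card : ℚ) ≤ (p : ℚ) := by exact_mod_cast this
        linarith
    calc wbar p q S₁.card S₂.card / ((mbar q KF.card S₁.card S₂.card : ℕ) : ℚ)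
        ≤ wbar p q S₁.card S₂.card / ((ruleMult M p q T : ℕ) : ℚ) :=
          div_le_div_of_nonneg_left hwbar_nonneg hm_pos' hm_le'
      _ ≤ ruleWeight M q T / ((ruleMult M p q T : ℕ) : ℚ) :=
          div_le_div_of_nonneg_right hw hm_pos'.le
  refine le_trans ?_ (Finset.sum_le_sum (fun S₁ hS₁ => Finset.sum_le_sum (fun S₂ hS₂ => hpt S₁ hS₁ S₂ hS₂)))
  -- the sum of `w̄/m̄` over the pairs is `NUM′`: group by cardinalities
  have hk_le : KF.card ≤ q := by
    have h := ncard_sdiff_closure_add_excess_le_S M hE hA hA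
    rw [← hK, Set.ncard_coe_finset] at h
    omega
  set k := KF.card with hk
  set d := p - q - 1 with hd
  -- inner sums as functions of the cardinalities
  have hinner : ∀ m : ℕ, ∑ S₂ ∈ XF.powerset.filter (fun S₂ => 1 ≤ S₂.card ∧ S₂.card ≤ d),
      wbar p q m S₂.card / ((mbar q k m S₂.card : ℕ) : ℚ) =
      ∑ s₂ ∈ Finset.Icc 1 d, (((p - k).choose s₂ : ℕ) : ℚ) * (wbar p q m s₂ / ((mbar q k m s₂ : ℕ) : ℚ)) := by
    intro m
    rw [Finset.sum_filter, Finset.sum_powerset_apply_card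
      (fun c => if 1 ≤ c ∧ c ≤ d then wbar p q m c / ((mbar q k m c : ℕ) : ℚ) else 0), hXcard]
    rw [← Finset.sum_filter_add_sum_filter_not (Finset.range (p - k + 1)) (fun c => 1 ≤ c ∧ c ≤ d)]
    have hI : (Finset.range (p - k + 1)).filter (fun c => 1 ≤ c ∧ c ≤ d) = Finset.Icc 1 d := by
      ext c
      simp only [Finset.mem_filter, Finset.mem_range, Finset.mem_Icc]
      omega
    have hz : ∑ c ∈ (Finset.range (p - k + 1)).filter (fun c => ¬ (1 ≤ c ∧ c ≤ d)),
        ((p - k).choose c) • (if 1 ≤ c ∧ c ≤ d then wbar p q m c / ((mbar q k m c : ℕ) : ℚ) else 0) = 0 := by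
      refine Finset.sum_eq_zero (fun c hc => ?_)
      rw [Finset.mem_filter] at hc
      rw [if_neg hc.2, smul_zero]
    rw [hI, hz, add_zero]
    refine Finset.sum_congr rfl (fun c hc => ?_)
    rw [Finset.mem_Icc] at hc
    rw [if_pos hc, nsmul_eq_mul]
  have houter : ∑ S₁ ∈ KF.powerset.filter (fun S₁ => 1 ≤ S₁.card),
      ∑ s₂ ∈ Finset.Icc 1 d, (((p - k).choose s₂ : ℕ) : ℚ) *
        (wbar p q S₁.card s₂ / ((mbar q k S₁.card s₂ : ℕ) : ℚ)) =
      ∑ s₁ ∈ Finset.Icc 1 k, ((k.choose s₁ : ℕ) : ℚ) * ∑ s₂ ∈ Finset.Icc 1 d,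
        (((p - k).choose s₂ : ℕ) : ℚ) * (wbar p q s₁ s₂ / ((mbar q k s₁ s₂ : ℕ) : ℚ)) := by
    rw [Finset.sum_filter, Finset.sum_powerset_apply_card
      (fun c => if 1 ≤ c then ∑ s₂ ∈ Finset.Icc 1 d, (((p - k).choose s₂ : ℕ) : ℚ) *
        (wbar p q c s₂ / ((mbar q k c s₂ : ℕ) : ℚ)) else 0)]
    rw [← Finset.sum_filter_add_sum_filter_not (Finset.range (KF.card + 1)) (fun c => 1 ≤ c)]
    have hI : (Finset.range (KF.card + 1)).filter (fun c => 1 ≤ c) = Finset.Icc 1 k := by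
      ext c
      simp only [Finset.mem_filter, Finset.mem_range, Finset.mem_Icc]
      omega
    have hz : ∑ c ∈ (Finset.range (KF.card + 1)).filter (fun c => ¬ (1 ≤ c)),
        (KF.card.choose c) • (if 1 ≤ c then ∑ s₂ ∈ Finset.Icc 1 d, (((p - k).choose s₂ : ℕ) : ℚ) *
          (wbar p q c s₂ / ((mbar q k c s₂ : ℕ) : ℚ)) else 0) = 0 := by
      refine Finset.sum_eq_zero (fun c hc => ?_)
      rw [Finset.mem_filter] at hc
      rw [if_neg hc.2, smul_zero]
    rw [hI, hz, add_zero]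
    refine Finset.sum_congr rfl (fun c hc => ?_)
    rw [Finset.mem_Icc] at hc
    rw [if_pos hc.1, nsmul_eq_mul]
  unfold numPrime
  calc ∑ s₁ ∈ Finset.Icc 1 k, ∑ s₂ ∈ Finset.Icc 1 (p - q - 1),
        ((k.choose s₁ : ℕ) : ℚ) * (((p - k).choose s₂ : ℕ) : ℚ) * wbar p q s₁ s₂ / ((mbar q k s₁ s₂ : ℕ) : ℚ)
      = ∑ s₁ ∈ Finset.Icc 1 k, ((k.choose s₁ : ℕ) : ℚ) * ∑ s₂ ∈ Finset.Icc 1 d,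
          (((p - k).choose s₂ : ℕ) : ℚ) * (wbar p q s₁ s₂ / ((mbar q k s₁ s₂ : ℕ) : ℚ)) := by
        refine Finset.sum_congr rfl (fun s₁ _ => ?_)
        rw [Finset.mul_sum]
        refine Finset.sum_congr rfl (fun s₂ _ => ?_)
        ring
    _ = ∑ S₁ ∈ KF.powerset.filter (fun S₁ => 1 ≤ S₁.card),
          ∑ s₂ ∈ Finset.Icc 1 d, (((p - k).choose s₂ : ℕ) : ℚ) *
            (wbar p q S₁.card s₂ / ((mbar q k S₁.card s₂ : ℕ) : ℚ)) := houter.symm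
    _ ≤ ∑ S₁ ∈ KF.powerset.filter (fun S₁ => 1 ≤ S₁.card),
          ∑ S₂ ∈ XF.powerset.filter (fun S₂ => 1 ≤ S₂.card ∧ S₂.card ≤ p - q - 1),
            wbar p q S₁.card S₂.card / ((mbar q k S₁.card S₂.card : ℕ) : ℚ) := by
        refine le_of_eq (Finset.sum_congr rfl (fun S₁ _ => ?_))
        rw [hinner S₁.card]

end PercRepro
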